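import Summits.CriticalPhenomena.CardyFormulaZ2.Theses.CardyComplexCone

/-!
# Sketch — crux-ideate stmt-CriticalPhenomena-11388 (CoherentMorera), ideator 3, round 1

First-lemma signatures for the idea cards `spin-shift-defect` and `finitary-green-pairing`.
Nothing here is proved; every `def … : Prop` must elaborate over existing declarations.
-/

noncomputable section

namespace Summit.CriticalPhenomena.CardyFormulaZ2.Theses.CardyComplexCone.Sketch11388

open scoped BigOperators Topology
open Filter MeasureTheory
open Literature.Probability.LatticeModels Literature.Probability.Percolation
open Literature.Probability.RandomPlanarGeometry

/-- Unit lattice vectors. -/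
abbrev e0 : Site 2 := Pi.single 0 1
abbrev e1 : Site 2 := Pi.single 1 1

/-- The spin-1/3 CORNER observable of the route (verbatim the `let E` of `EdgeCoherence`):
`E_δ(v,f) = E[ Σ_{passages of the corner (v,f)} exp(−(i/3)·W) ]`, `W` the winding of the medial
exploration polyline up to and including the corner segment. -/
def cornerObs (Λ : ℝ → DiscreteDobrushin) (δ : ℝ) (v f : Site 2) : ℂ :=
  ∫ ω, (let γ := medialExploration (Λ δ) ω;
    ∑ k ∈ (Finset.range γ.length).filter (fun k => γ[k]? = some (cornerSource v f) ∧
        γ[k + 1]? = some (cornerTarget v f)),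
      Complex.exp (-(Complex.I / 3) * ((winding ((γ.map (medialPoint δ)).take (k + 2)) : ℝ) : ℂ)))
    ∂(bondPercolation (zdGraph 2) half)

/-- ℤ₄-Fourier mode `k = 0` of the four corner classes at the SITE `v` = the spin-1/3 site observable
`A_{1/3}(v) = Σ_r S_r(v)` (plain sum of the four corners `(v,v)`, `(v,v−e₀)`, `(v,v−e₀−e₁)`, `(v,v−e₁)`). -/
def siteModeZero (Λ : ℝ → DiscreteDobrushin) (δ : ℝ) (v : Site 2) : ℂ :=
  cornerObs Λ δ v v + cornerObs Λ δ v (v - e0) + cornerObs Λ δ v (v - e0 - e1) + cornerObs Λ δ v (v - e1)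

/-- ℤ₄-Fourier mode `k = 2` = the spin-7/3 (≡ −5/3) site observable `A_{7/3}(v) = Σ_r (−1)^r S_r(v)`:
the ALTERNATING sum, travel classes {NW, SE} minus {SW, NE} (pathwise `(−1)^{n} e^{−iπn/6} = e^{−i(7/3)W}`,
`W = nπ/2`). -/
def siteModeTwo (Λ : ℝ → DiscreteDobrushin) (δ : ℝ) (v : Site 2) : ℂ :=
  cornerObs Λ δ v v - cornerObs Λ δ v (v - e0) + cornerObs Λ δ v (v - e0 - e1) - cornerObs Λ δ v (v - e1)

/-- `∂̄φ` and `∂φ` of a real-differentiable test function (as in the route's WeakHolomorphy clause). -/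
def dbar (φ : ℂ → ℂ) (p : ℂ) : ℂ := (fderiv ℝ φ p 1 + Complex.I * fderiv ℝ φ p Complex.I) / 2
def del (φ : ℂ → ℂ) (p : ℂ) : ℂ := (fderiv ℝ φ p 1 - Complex.I * fderiv ℝ φ p Complex.I) / 2

/-- The family guards of the route (domain, mesh, eventual admissibility). -/
def Guards (D : DobrushinDomain) (Λ : ℝ → DiscreteDobrushin) : Prop :=
  (∀ δ, (Λ δ).Ω = D.carrier) ∧ (∀ δ, (Λ δ).δ = δ) ∧ (∀ᶠ δ in 𝓝[>] (0:ℝ), (Λ δ).IsZdAdmissible)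

/-- Admissible test functions for the domain `D`. -/
def TestFn (D : DobrushinDomain) (φ : ℂ → ℂ) : Prop :=
  ContDiff ℝ (⊤ : ℕ∞) φ ∧ HasCompactSupport φ ∧ tsupport φ ⊆ D.carrier

/-- Mode-0 (spin-1/3) `∂̄`-pairing tends to zero for one family and one test function. -/
def ModeZeroPairingNull (Λ : ℝ → DiscreteDobrushin) (φ : ℂ → ℂ) : Prop :=
  Tendsto (fun δ : ℝ => ((δ ^ ((5:ℝ) / 3) : ℝ) : ℂ) *
    ∑ᶠ v : Site 2, siteModeZero Λ δ v * dbar φ (meshPoint δ v)) (𝓝[>] (0:ℝ)) (𝓝 0)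

/-- Mode-2 (spin-7/3) `∂`-pairing tends to zero for one family and one test function. -/
def ModeTwoPairingNull (Λ : ℝ → DiscreteDobrushin) (φ : ℂ → ℂ) : Prop :=
  Tendsto (fun δ : ℝ => ((δ ^ ((5:ℝ) / 3) : ℝ) : ℂ) *
    ∑ᶠ v : Site 2, siteModeTwo Λ δ v * del φ (meshPoint δ v)) (𝓝[>] (0:ℝ)) (𝓝 0)

/-- The crux's weak-holomorphy pairing of the VERTEX observable for one family and one test function
(verbatim the body of conclusion (i)). -/
def VertexPairingNull (Λ : ℝ → DiscreteDobrushin) (φ : ℂ → ℂ) : Prop :=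
  Tendsto (fun δ : ℝ => ((δ ^ ((5:ℝ) / 3) : ℝ) : ℂ) * ∑ᶠ z : Literature.Probability.LatticeModels.MedialVertex, (∫ ω, Literature.Probability.LatticeModels.passageSum (Literature.Probability.LatticeModels.medialExploration (Λ δ) ω) δ (1 / 3) z ∂(Literature.Probability.Percolation.bondPercolation (Literature.Probability.LatticeModels.zdGraph 2) Literature.Probability.Percolation.half)) * ((fderiv ℝ φ (Literature.Probability.LatticeModels.medialPoint δ z) 1 + Complex.I * fderiv ℝ φ (Literature.Probability.LatticeModels.medialPoint δ z) Complex.I) / 2)) (𝓝[>] (0:ℝ)) (𝓝 0)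

/-- CARD `spin-shift-defect`, FIRST LEMMA (unconditional lattice theorem, chirality `c = i`):
the exact DC12-Prop-4 vertex relation, paired with a test function and Taylor-expanded along the medial
edges, reads `∂̄ A_{1/3} = i ∂ A_{7/3}` weakly at scale `δ^{1/3}`:
`δ^{5/3} Σ_v [A_{1/3}(v) ∂̄φ(v_δ) − i A_{7/3}(v) ∂φ(v_δ)] → 0` — in fact `= O(δ^{2/3})` using only
`|E_δ(c)| ≤ 1`.  (For the conjugate chirality `c = −i` swap `∂̄ ↔ ∂` and `−i ↔ +i`.) -/
def SpinShiftPairing : Prop :=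
  ∀ (D : DobrushinDomain) (Λ : ℝ → DiscreteDobrushin), (∀ δ, (Λ δ).Ω = D.carrier) → (∀ δ, (Λ δ).δ = δ) →
    (∀ᶠ δ in 𝓝[>] (0:ℝ), (Λ δ).IsZdAdmissible) →
    ∀ (φ : ℂ → ℂ), ContDiff ℝ (⊤ : ℕ∞) φ → HasCompactSupport φ → tsupport φ ⊆ D.carrier →
      Tendsto (fun δ : ℝ => ((δ ^ ((5:ℝ) / 3) : ℝ) : ℂ) *
        ∑ᶠ v : Site 2, (siteModeZero Λ δ v * dbar φ (meshPoint δ v)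
          - Complex.I * siteModeTwo Λ δ v * del φ (meshPoint δ v))) (𝓝[>] (0:ℝ)) (𝓝 0)

/-- The reformulated obstruction: the spin-7/3 site observable is weakly `∂`-null at scale `δ^{1/3}`. -/
def Spin73WeakNull : Prop :=
  ∀ (D : DobrushinDomain) (Λ : ℝ → DiscreteDobrushin), (∀ δ, (Λ δ).Ω = D.carrier) → (∀ δ, (Λ δ).δ = δ) →
    (∀ᶠ δ in 𝓝[>] (0:ℝ), (Λ δ).IsZdAdmissible) →
    ∀ (φ : ℂ → ℂ), ContDiff ℝ (⊤ : ℕ∞) φ → HasCompactSupport φ → tsupport φ ⊆ D.carrier →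
      Tendsto (fun δ : ℝ => ((δ ^ ((5:ℝ) / 3) : ℝ) : ℂ) *
        ∑ᶠ v : Site 2, siteModeTwo Λ δ v * del φ (meshPoint δ v)) (𝓝[>] (0:ℝ)) (𝓝 0)

/-- Conclusion (i) of the crux (weak holomorphy of the spin-1/3 VERTEX observable), copied verbatim. -/
def WeakHolomorphyFamilies : Prop :=
  ∀ (D : Literature.Probability.RandomPlanarGeometry.DobrushinDomain) (Λ : ℝ → Literature.Probability.LatticeModels.DiscreteDobrushin), (∀ δ, (Λ δ).Ω = D.carrier) → (∀ δ, (Λ δ).δ = δ) → (∀ᶠ δ in 𝓝[>] (0:ℝ), (Λ δ).IsZdAdmissible) → ∀ (φ : ℂ → ℂ), ContDiff ℝ (⊤ : ℕ∞) φ → HasCompactSupport φ → tsupport φ ⊆ D.carrier → Tendsto (fun δ : ℝ => ((δ ^ ((5:ℝ) / 3) : ℝ) : ℂ) * ∑ᶠ z : Literature.Probability.LatticeModels.MedialVertex, (∫ ω, Literature.Probability.LatticeModels.passageSum (Literature.Probability.LatticeModels.medialExploration (Λ δ) ω) δ (1 / 3) z ∂(Literature.Probability.Percolation.bondPercolation (Literature.Probability.LatticeModels.zdGraph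 2) Literature.Probability.Percolation.half)) * ((fderiv ℝ φ (Literature.Probability.LatticeModels.medialPoint δ z) 1 + Complex.I * fderiv ℝ φ (Literature.Probability.LatticeModels.medialPoint δ z) Complex.I) / 2)) (𝓝[>] (0:ℝ)) (𝓝 0)

/-- Conclusion (ii) of the crux (vertex precompactness on lattice edges), copied verbatim. -/
def VertexPrecompactFamilies : Prop :=
  ∀ (D : Literature.Probability.RandomPlanarGeometry.DobrushinDomain) (Λ : ℝ → Literature.Probability.LatticeModels.DiscreteDobrushin), (∀ δ, (Λ δ).Ω = D.carrier) → (∀ δ, (Λ δ).δ = δ) → (∀ᶠ δ in 𝓝[>] (0:ℝ), (Λ δ).IsZdAdmissible) → let F : ℝ → Literature.Probability.LatticeModels.MedialVertex → ℂ := fun δ z => ∫ ω, Literature.Probability.LatticeModels.passageSum (Literature.Probability.LatticeModels.medialExploration (Λ δ) ω) δ (1 / 3) z ∂(Literature.Probability.Percolation.bondPercolation (Literature.Probability.LatticeModels.zdGraph 2) Literature.Probability.Percolation.half); ∀ K : Set ℂ, IsCompact K → K ⊆ D.carrier → (∃ C : ℝ, ∀ᶠ δ in 𝓝[>] (0:ℝ),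 ∀ z : Literature.Probability.LatticeModels.MedialVertex, z ∈ (Literature.Probability.LatticeModels.zdGraph 2).edgeSet → Literature.Probability.LatticeModels.medialPoint δ z ∈ K → ‖F δ z‖ ≤ C * δ ^ ((1:ℝ) / 3)) ∧ (∀ ε > (0:ℝ), ∃ η > (0:ℝ), ∀ᶠ δ in 𝓝[>] (0:ℝ), ∀ z z' : Literature.Probability.LatticeModels.MedialVertex, z ∈ (Literature.Probability.LatticeModels.zdGraph 2).edgeSet → z' ∈ (Literature.Probability.LatticeModels.zdGraph 2).edgeSet → Literature.Probability.LatticeModels.medialPoint δ z ∈ K → Literature.Probability.LatticeModels.medialPoint δ z' ∈ K → dist (Literature.Probability.LatticeModels.medialPoint δ z) (Literature.Probability.LatticeModels.medialPoint δ z') < η → ‖F δ z - F δ z'‖ ≤ ε * δ ^ ((1:ℝ) / 3))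

/-- Certificate that the two copies are the crux's conclusion. -/
theorem coherentMorera_iff :
    CoherentMorera ↔ (EdgeCoherence → EdgePrecompact → (WeakHolomorphyFamilies ∧ VertexPrecompactFamilies)) :=
  Iff.rfl

/-- CARD `spin-shift-defect`: the corner→vertex resummation — the crux's vertex pairing and the
mode-0 site pairing differ by `o(1)` (pathwise corner→vertex identity + an `O(δ)` shift of the test
function), so they tend to zero together. Unconditional. -/
def VertexToModeZero : Prop :=
  ∀ (D : DobrushinDomain) (Λ : ℝ → DiscreteDobrushin), Guards D Λ → ∀ φ, TestFn D φ →
    (VertexPairingNull Λ φ ↔ ModeZeroPairingNull Λ φ)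

/-- CARD `spin-shift-defect`: consequence of `SpinShiftPairing` — the two mode pairings tend to zero
together (THE reformulation: Morera for the percolation parafermion ⟺ weak ∂-nullity of spin 7/3). -/
def PairingIdentity : Prop :=
  ∀ (D : DobrushinDomain) (Λ : ℝ → DiscreteDobrushin), Guards D Λ → ∀ φ, TestFn D φ →
    (ModeZeroPairingNull Λ φ ↔ ModeTwoPairingNull Λ φ)

/-- The only place coherence (and π/2-rotation covariance) enters: under `EdgeCoherence` and the local
bound, for every family and test function one of the two mode pairings tends to zero
(characters: `û₀ û₂ = 0`; non-characters: rotation covariance forces `e_δ = o(δ^{1/3})`). -/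
def CoherenceKillsModeTwoOrZero : Prop :=
  EdgeCoherence → EdgePrecompact →
    ∀ (D : DobrushinDomain) (Λ : ℝ → DiscreteDobrushin), Guards D Λ → ∀ φ, TestFn D φ →
      (ModeZeroPairingNull Λ φ ∨ ModeTwoPairingNull Λ φ)

/-- Conclusion (ii) needs the edge precompactness only (corner→vertex identity; every lattice-edge medial
vertex carries one corner of each class). -/
def PrecompactTransfer : Prop := EdgePrecompact → VertexPrecompactFamilies

/-- CARD `spin-shift-defect`, TRANSFER `C⁺` (no coherence vector, no character, no rotation). -/
def CoherentMoreraPlus : Prop :=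
  Spin73WeakNull → EdgePrecompact → (WeakHolomorphyFamilies ∧ VertexPrecompactFamilies)

/-- `C⁺` is pure logic from the two unconditional lemmas. -/
theorem coherentMoreraPlus_of (hV : VertexToModeZero) (hP : PairingIdentity) (hT : PrecompactTransfer) :
    CoherentMoreraPlus := by
  intro h73 hPre
  refine ⟨?_, hT hPre⟩
  intro D Λ hΩ hδ hAdm φ hφ hsupp hsub
  have hG : Guards D Λ := ⟨hΩ, hδ, hAdm⟩
  have hF : TestFn D φ := ⟨hφ, hsupp, hsub⟩
  have h2 : ModeTwoPairingNull Λ φ := h73 D Λ hΩ hδ hAdm φ hφ hsupp hsub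
  exact (hV D Λ hG φ hF).2 ((hP D Λ hG φ hF).2 h2)

/-- THE CRUX from the cards' lemmas — pure logic (certificate that the decomposition concludes
`CoherentMorera` BY NAME). -/
theorem coherentMorera_of (hV : VertexToModeZero) (hP : PairingIdentity) (hK : CoherenceKillsModeTwoOrZero)
    (hT : PrecompactTransfer) : CoherentMorera := by
  intro hC hPre
  refine ⟨?_, hT hPre⟩
  intro D Λ hΩ hδ hAdm φ hφ hsupp hsub
  have hG : Guards D Λ := ⟨hΩ, hδ, hAdm⟩
  have hF : TestFn D φ := ⟨hφ, hsupp, hsub⟩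
  rcases hK hC hPre D Λ hG φ hF with h0 | h2
  · exact (hV D Λ hG φ hF).2 h0
  · exact (hV D Λ hG φ hF).2 ((hP D Λ hG φ hF).2 h2)

/-- CARD `finitary-green-pairing`, FIRST LEMMA (deterministic, quantitative, no limit objects):
for ANY corner function `G` obeying the vertex relation with chirality `i` at the medial vertices whose
four corners have midpoints in an open `U ⊇ tsupport φ`, and bounded by `M` there,
`‖Σ_v [(Σ_r G_r(v)) ∂̄φ(δv) − i (Σ_r (−1)^r G_r(v)) ∂φ(δv)]‖ ≤ C(φ,U) · M / δ` for small `δ`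
(summation by parts moves the lattice difference operator onto `φ`; the `O(1/δ²)·M` terms cancel by the
relation, the `O(1/δ)·M` remainder is a second-order Taylor term). The relation and the corner table are
inlined exactly as in `CardySublatticeCoherence.HalfCRVertexRelation`. -/
def HalfCRPairingBound : Prop :=
  let mid : ℝ → Site 2 × Site 2 → ℂ := fun δ c =>
    (medialPoint δ (cornerSource c.1 c.2) + medialPoint δ (cornerTarget c.1 c.2)) / 2
  let corners : Site 2 × Fin 2 → Fin 4 → Site 2 × Site 2 := fun p k =>
    if p.2 = 0 then (![(p.1, p.1), (p.1 + e0, p.1), (p.1 + e0, p.1 - e1), (p.1, p.1 - e1)] : Fin 4 → Site 2 × Site 2) k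
    else (![(p.1 + e1, p.1 - e0), (p.1 + e1, p.1), (p.1, p.1), (p.1, p.1 - e0)] : Fin 4 → Site 2 × Site 2) k
  let rel : ℂ → (Site 2 × Site 2 → ℂ) → Site 2 × Fin 2 → Prop := fun χ F p =>
    F (corners p 0) - F (corners p 2) = χ * (F (corners p 1) - F (corners p 3))
  ∀ (U : Set ℂ), IsOpen U → ∀ (φ : ℂ → ℂ), ContDiff ℝ 3 φ → HasCompactSupport φ → tsupport φ ⊆ U →
    ∃ C : ℝ, ∃ δ₀ > (0:ℝ), ∀ δ : ℝ, 0 < δ → δ ≤ δ₀ →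
      ∀ (G : Site 2 × Site 2 → ℂ) (M : ℝ), 0 ≤ M →
        (∀ c : Site 2 × Site 2, IsCorner c.1 c.2 → mid δ c ∈ U → ‖G c‖ ≤ M) →
        (∀ p : Site 2 × Fin 2, (∀ k : Fin 4, mid δ (corners p k) ∈ U) → rel Complex.I G p) →
        ‖∑ᶠ v : Site 2, ((G (v, v) + G (v, v - e0) + G (v, v - e0 - e1) + G (v, v - e1)) * dbar φ (meshPoint δ v)
            - Complex.I * (G (v, v) - G (v, v - e0) + G (v, v - e0 - e1) - G (v, v - e1)) * del φ (meshPoint δ v))‖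
          ≤ C * M / δ

/-- CARD `finitary-green-pairing`, the pathwise corner→vertex identity (both cards use it): away from the
two `A`–`B` edges, the passage sum at a medial vertex equals `(2 cos(π/12))⁻¹ ×` the sum of the corner
phase sums over the four incident corners (each visit = one incoming + one outgoing corner, turn `±π/2`,
`windingAt` = bisected turn). -/
def CornerVertexIdentity : Prop :=
  let corners : Site 2 × Fin 2 → Fin 4 → Site 2 × Site 2 := fun p k =>
    if p.2 = 0 then (![(p.1, p.1), (p.1 + e0, p.1), (p.1 + e0, p.1 - e1), (p.1, p.1 - e1)] : Fin 4 → Site 2 × Site 2) k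
    else (![(p.1 + e1, p.1 - e0), (p.1 + e1, p.1), (p.1, p.1), (p.1, p.1 - e0)] : Fin 4 → Site 2 × Site 2) k
  let cornerPhase : List MedialVertex → ℝ → Site 2 × Site 2 → ℂ := fun γ δ c =>
    ∑ k ∈ (Finset.range γ.length).filter (fun k => γ[k]? = some (cornerSource c.1 c.2) ∧
        γ[k + 1]? = some (cornerTarget c.1 c.2)),
      Complex.exp (-(Complex.I / 3) * ((winding ((γ.map (medialPoint δ)).take (k + 2)) : ℝ) : ℂ))
  ∀ (E : DiscreteDobrushin), E.IsZdAdmissible → ∀ (ω : BondConfig (Site 2)) (p : Site 2 × Fin 2),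
    s(p.1, p.1 + Pi.single p.2 1) ∉ E.zdABEdges →
      passageSum (medialExploration E ω) E.δ (1 / 3) s(p.1, p.1 + Pi.single p.2 1) =
        ((2 * Real.cos (Real.pi / 12))⁻¹ : ℝ) * ∑ k : Fin 4, cornerPhase (medialExploration E ω) E.δ (corners p k)


/-- CARD `finitary-green-pairing`: the matrix of `EdgeCoherence` with the class vector `u` free (verbatim copy). -/
def EdgeCoherenceWith (u : Site 2 → ℂ) : Prop :=
  ∀ (D : Literature.Probability.RandomPlanarGeometry.DobrushinDomain) (Λ : ℝ → Literature.Probability.LatticeModels.DiscreteDobrushin), (∀ δ, (Λ δ).Ω = D.carrier) → (∀ δ, (Λ δ).δ = δ) → (∀ᶠ δ in nhdsWithin (0:ℝ) (Set.Ioi 0), (Λ δ).IsZdAdmissible) → let E : ℝ → Literature.Probability.LatticeModels.Site 2 → Literature.Probability.LatticeModels.Site 2 → ℂ := fun δ v f => ∫ ω, (let γ := Literature.Probability.LatticeModels.medialExploration (Λ δ) ω; ∑ k ∈ (Finset.range γ.length).filter (fun k => γ[k]? = some (Literature.Probability.LatticeModels.cornerSource v f) ∧ γ[k + 1]? = some (Literature.Probability.LatticeModels.cornerTarget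 v f)), Complex.exp (-(Complex.I / 3) * ((Literature.Probability.LatticeModels.winding ((γ.map (Literature.Probability.LatticeModels.medialPoint δ)).take (k + 2)) : ℝ) : ℂ))) ∂(Literature.Probability.Percolation.bondPercolation (Literature.Probability.LatticeModels.zdGraph 2) Literature.Probability.Percolation.half); ∀ K : Set ℂ, IsCompact K → K ⊆ D.carrier → ∀ ε > (0:ℝ), ∀ᶠ δ in nhdsWithin (0:ℝ) (Set.Ioi 0), ∀ v f f' : Literature.Probability.LatticeModels.Site 2, Literature.Probability.LatticeModels.IsCorner v f → Literature.Probability.LatticeModels.IsCorner v f' → Literature.Probability.LatticeModels.meshPoint δ v ∈ K → ‖u (f' - v) * E δ v f - u (f - v) * E δ v f'‖ ≤ ε * δ ^ ((1:ℝ) / 3)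

/-- Certificate of the copy. -/
theorem edgeCoherence_iff : EdgeCoherence ↔ ∃ u : Site 2 → ℂ, (∃ o : Site 2, IsCorner 0 o ∧ u o ≠ 0) ∧ EdgeCoherenceWith u :=
  Iff.rfl

/-- The ℤ₄ shift of corner classes induced by the quarter turn `(a,b) ↦ (−b,a)` of `ℤ²` (faces re-indexed by their new
lower-left corner): offsets `0 ↦ −e₀ ↦ −e₀−e₁ ↦ −e₁ ↦ 0` (travel classes NW ↦ SW ↦ SE ↦ NE ↦ NW). -/
def classShift (o : Site 2) : Site 2 := ![-(o 1), o 0] - e0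

/-- CARD `finitary-green-pairing`, FIRST LEMMA (b): universality over ROTATED domains makes the set of coherence vectors
ℤ₄-invariant — proved by conjugating the corner-orbit dynamics (`cornerOrbit`/`explorationList`) by the quarter turn:
`E^{RΛ}_δ(R·c) = E^{Λ}_δ(c)` exactly, classes shift by one, windings are unchanged. -/
def CoherenceShift : Prop :=
  ∀ u : Site 2 → ℂ, EdgeCoherenceWith u → EdgeCoherenceWith (fun o => u (classShift o))

/-- CARD `finitary-green-pairing`: CHARACTER OR NULL (finitary dichotomy, no limit direction). Under coherence with `u`
and the local bound, on every compact of every family: either `u` is an exact ℤ₄-eigenvector of the class shift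
(a character), or the corner observable is `o(δ^{1/3})` there (and then both mode pairings vanish trivially). -/
def CharacterOrNull : Prop :=
  ∀ u : Site 2 → ℂ, (∃ o : Site 2, IsCorner 0 o ∧ u o ≠ 0) → EdgeCoherenceWith u → EdgePrecompact →
    (∃ χ : ℂ, ∀ o : Site 2, IsCorner 0 o → u (classShift o) = χ * u o) ∨
    ∀ (D : DobrushinDomain) (Λ : ℝ → DiscreteDobrushin), Guards D Λ →
      ∀ K : Set ℂ, IsCompact K → K ⊆ D.carrier → ∀ ε > (0:ℝ), ∀ᶠ δ in 𝓝[>] (0:ℝ),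
        ∀ v f : Site 2, IsCorner v f → meshPoint δ v ∈ K → ‖cornerObs Λ δ v f‖ ≤ ε * δ ^ ((1:ℝ) / 3)

/-- CARD `finitary-green-pairing`: the coherence-consuming half of the crux is pure bookkeeping from the two lemmas above
plus `HalfCRPairingBound` (characters have `û₀·û₂ = 0`; null data kill both pairings). Stated, not proved here. -/
def CoherenceKillsModeTwoOrZero_of : Prop :=
  CoherenceShift → CharacterOrNull → HalfCRPairingBound → CoherenceKillsModeTwoOrZero

end Summit.CriticalPhenomena.CardyFormulaZ2.Theses.CardyComplexCone.Sketch11388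

end
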